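import Mathlib.Analysis.SpecialFunctions.Pow.Real
import Mathlib.Tactic
import HarnessLib

/-!
# The band-level interaction annex of technique B: `U_B = a⁴U_dd + (1−a²)²U_pp/4 + 2a²(1−a²)U_pd` and its box rule

Venture CertifiedManyBodySolver, cell `pub/hubbard-downfold` (stage S1 = ROUTER; INFLATION-RULES-3to1-B §B.4/§B.14: the
U leg of the three-band → one-band reduction), seat hubbard-downfold-mod-4; namespace
`Summit.Ventures.CertifiedManyBodySolver.Downfold.Emery`. Everything here is PROVED (elementary real algebra). WHAT THIS IS
NOT: a cRPA calculation or a statement about screening; `U_B` is the MEAN-FIELD PROJECTION of the three-band density–density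
interactions onto the antibonding band with Cu-d weight `w = a²` (O weight `1 − w` split over two oxygens), an ANNEX of
technique B (upper-biased: it neglects the p→d screening that a one-band cRPA integrates out); located checks: La₂CuO₄ own-run
pair U_B/U_1b = 1.13–1.37, YNiO₂ (Hirayama 2022 T.1 pair) 1.03 (§B.14).

* `bandLevelU w Udd Upp Upd = w²·Udd + (1 − w)²·Upp/4 + 2w(1 − w)·Upd` (`w = a²` the d weight);
* monotone in each interaction for `0 ≤ w ≤ 1` (`bandLevelU_mono_Udd/_Upp/_Upd`), hence the U-box rule
  `bandLevelU_mem_Icc_of_U` at fixed `w`;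
* in `w` it is the quadratic `κ w² − 2λ w + Upp/4` with curvature `κ = Udd + Upp/4 − 2Upd` and `λ = Upp/4 − Upd`
  (`bandLevelU_eq_quadratic`); for `κ ≥ 0` (every cuprate/nickelate set of record: U_dd ≫ 2U_pd) it is CONVEX in `w`, so on
  a weight interval `[w₁, w₂]` its MAXIMUM is at an end point (`bandLevelU_le_max_of_convex`) and it is bounded BELOW by the
  tangent/secant device: `bandLevelU_ge_of_deriv_nonneg` — if the derivative at `w₁` is `≥ 0` (i.e. `κ w₁ ≥ λ`, the increasing
  branch: d-weight above the vertex, the cuprate case `w ≈ 0.65–0.8`) then the MINIMUM is at `w₁`; together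
  `bandLevelU_mem_Icc_increasing` = the full box rule on `[w₁, w₂] × [U-box]` in the increasing regime.
-/

namespace Summit.Ventures.CertifiedManyBodySolver.Downfold.Emery

/-- **The band-level interaction** of the antibonding band with Cu-d weight `w = a²`:
`U_B = w²·U_dd + (1−w)²·U_pp/4 + 2w(1−w)·U_pd` (INFLATION-RULES-3to1-B §B.4 convention: O weight `b² = 1 − w` shared by the
two oxygens ⇒ on-site O term `b⁴/4`, d–p cross term `2a²b²`). [folklore] -/
noncomputable def bandLevelU (w Udd Upp Upd : ℝ) : ℝ :=
  w ^ 2 * Udd + (1 - w) ^ 2 * Upp / 4 + 2 * w * (1 - w) * Upd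

/-- `U_B` as a quadratic in the d weight: `κw² − 2λw + U_pp/4`, `κ = U_dd + U_pp/4 − 2U_pd`, `λ = U_pp/4 − U_pd`. [folklore] -/
theorem bandLevelU_eq_quadratic (w Udd Upp Upd : ℝ) :
    bandLevelU w Udd Upp Upd = (Udd + Upp / 4 - 2 * Upd) * w ^ 2 - 2 * (Upp / 4 - Upd) * w + Upp / 4 := by
  unfold bandLevelU; ring

/-- Monotone in `U_dd`. [folklore] -/
theorem bandLevelU_mono_Udd (w Upp Upd : ℝ) {U U' : ℝ} (h : U ≤ U') :
    bandLevelU w U Upp Upd ≤ bandLevelU w U' Upp Upd := by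
  unfold bandLevelU; nlinarith [sq_nonneg w]

/-- Monotone in `U_pp`. [folklore] -/
theorem bandLevelU_mono_Upp (w Udd Upd : ℝ) {U U' : ℝ} (h : U ≤ U') :
    bandLevelU w Udd U Upd ≤ bandLevelU w Udd U' Upd := by
  unfold bandLevelU; nlinarith [sq_nonneg (1 - w)]

/-- Monotone in `U_pd` for `0 ≤ w ≤ 1`. [folklore] -/
theorem bandLevelU_mono_Upd {w : ℝ} (hw0 : 0 ≤ w) (hw1 : w ≤ 1) (Udd Upp : ℝ) {U U' : ℝ} (h : U ≤ U') :
    bandLevelU w Udd Upp U ≤ bandLevelU w Udd Upp U' := by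
  unfold bandLevelU
  have : 0 ≤ 2 * w * (1 - w) := by nlinarith
  nlinarith

/-- **U-box rule at fixed weight**: interactions in a box ⇒ `U_B` between its values at the lower and upper corners.
[folklore] -/
theorem bandLevelU_mem_Icc_of_U {w : ℝ} (hw0 : 0 ≤ w) (hw1 : w ≤ 1) {d₁ d₂ p₁ p₂ x₁ x₂ Udd Upp Upd : ℝ}
    (hd : Udd ∈ Set.Icc d₁ d₂) (hp : Upp ∈ Set.Icc p₁ p₂) (hx : Upd ∈ Set.Icc x₁ x₂) :
    bandLevelU w Udd Upp Upd ∈ Set.Icc (bandLevelU w d₁ p₁ x₁) (bandLevelU w d₂ p₂ x₂) := by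
  constructor
  · calc bandLevelU w d₁ p₁ x₁ ≤ bandLevelU w Udd p₁ x₁ := bandLevelU_mono_Udd _ _ _ hd.1
      _ ≤ bandLevelU w Udd Upp x₁ := bandLevelU_mono_Upp _ _ _ hp.1
      _ ≤ bandLevelU w Udd Upp Upd := bandLevelU_mono_Upd hw0 hw1 _ _ hx.1
  · calc bandLevelU w Udd Upp Upd ≤ bandLevelU w d₂ Upp Upd := bandLevelU_mono_Udd _ _ _ hd.2
      _ ≤ bandLevelU w d₂ p₂ Upd := bandLevelU_mono_Upp _ _ _ hp.2
      _ ≤ bandLevelU w d₂ p₂ x₂ := bandLevelU_mono_Upd hw0 hw1 _ _ hx.2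

/-- **Convex in the weight ⇒ maximum at an end point**: for `κ = U_dd + U_pp/4 − 2U_pd ≥ 0` and `w ∈ [w₁, w₂]`,
`U_B(w) ≤ max (U_B(w₁)) (U_B(w₂))`. [folklore] -/
theorem bandLevelU_le_max_of_convex {Udd Upp Upd w₁ w₂ w : ℝ} (hκ : 0 ≤ Udd + Upp / 4 - 2 * Upd)
    (hw : w ∈ Set.Icc w₁ w₂) :
    bandLevelU w Udd Upp Upd ≤ max (bandLevelU w₁ Udd Upp Upd) (bandLevelU w₂ Udd Upp Upd) := by
  rcases hw with ⟨h₁, h₂⟩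
  rcases eq_or_lt_of_le (le_trans h₁ h₂) with heq | hlt
  · have : w = w₁ := le_antisymm (heq ▸ h₂) h₁
    subst this; exact le_max_left _ _
  -- convex combination w = l w₁ + m w₂
  set κ := Udd + Upp / 4 - 2 * Upd with hκdef
  have key : ∀ v, bandLevelU v Udd Upp Upd = κ * v ^ 2 - 2 * (Upp / 4 - Upd) * v + Upp / 4 := fun v => by
    rw [bandLevelU_eq_quadratic]
  -- a convex quadratic lies below the chord
  have hchord : bandLevelU w Udd Upp Upd ≤
      ((w₂ - w) * bandLevelU w₁ Udd Upp Upd + (w - w₁) * bandLevelU w₂ Udd Upp Upd) / (w₂ - w₁) := by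
    rw [le_div_iff₀ (sub_pos.2 hlt), key w, key w₁, key w₂]
    have hprod : 0 ≤ κ * ((w - w₁) * (w₂ - w)) := mul_nonneg hκ (mul_nonneg (sub_nonneg.2 h₁) (sub_nonneg.2 h₂))
    nlinarith
  refine hchord.trans ?_
  rw [div_le_iff₀ (sub_pos.2 hlt)]
  have hm₁ := le_max_left (bandLevelU w₁ Udd Upp Upd) (bandLevelU w₂ Udd Upp Upd)
  have hm₂ := le_max_right (bandLevelU w₁ Udd Upp Upd) (bandLevelU w₂ Udd Upp Upd)
  have a0 : 0 ≤ w₂ - w := sub_nonneg.2 h₂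
  have b0 : 0 ≤ w - w₁ := sub_nonneg.2 h₁
  nlinarith [mul_le_mul_of_nonneg_left hm₁ a0, mul_le_mul_of_nonneg_left hm₂ b0]

/-- **Increasing branch ⇒ minimum at the left end**: if `κ ≥ 0` and the derivative at `w₁` is non-negative
(`κ·w₁ ≥ U_pp/4 − U_pd`), then `U_B(w₁) ≤ U_B(w)` for `w₁ ≤ w`. [folklore] -/
theorem bandLevelU_ge_of_deriv_nonneg {Udd Upp Upd w₁ w : ℝ} (hκ : 0 ≤ Udd + Upp / 4 - 2 * Upd)
    (hderiv : Upp / 4 - Upd ≤ (Udd + Upp / 4 - 2 * Upd) * w₁) (hw : w₁ ≤ w) :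
    bandLevelU w₁ Udd Upp Upd ≤ bandLevelU w Udd Upp Upd := by
  rw [bandLevelU_eq_quadratic, bandLevelU_eq_quadratic]
  have h1 : 0 ≤ w - w₁ := sub_nonneg.2 hw
  have h2 : 0 ≤ (Udd + Upp / 4 - 2 * Upd) * (w - w₁) ^ 2 := mul_nonneg hκ (sq_nonneg _)
  nlinarith [mul_nonneg h1 (sub_nonneg.2 hderiv)]

/-- **THE BOX RULE in the increasing regime** (`κ ≥ 0`, derivative `≥ 0` at `w₁`, `0 ≤ w₁ ≤ w₂ ≤ 1`): for
`w ∈ [w₁, w₂]` and interactions in their boxes,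
`U_B ∈ [U_B(w₁; lower U corner), U_B(w₂; upper U corner)]`. [folklore] -/
theorem bandLevelU_mem_Icc_increasing {d₁ d₂ p₁ p₂ x₁ x₂ w₁ w₂ w Udd Upp Upd : ℝ} (hw₁0 : 0 ≤ w₁) (hw₂1 : w₂ ≤ 1)
    (hw : w ∈ Set.Icc w₁ w₂) (hd : Udd ∈ Set.Icc d₁ d₂) (hp : Upp ∈ Set.Icc p₁ p₂) (hx : Upd ∈ Set.Icc x₁ x₂)
    (hκ₁ : 0 ≤ d₁ + p₁ / 4 - 2 * x₁) (hderiv₁ : p₁ / 4 - x₁ ≤ (d₁ + p₁ / 4 - 2 * x₁) * w₁)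
    (hκ₂ : 0 ≤ d₂ + p₂ / 4 - 2 * x₂) (hderiv₂ : p₂ / 4 - x₂ ≤ (d₂ + p₂ / 4 - 2 * x₂) * w₁) :
    bandLevelU w Udd Upp Upd ∈ Set.Icc (bandLevelU w₁ d₁ p₁ x₁) (bandLevelU w₂ d₂ p₂ x₂) := by
  have hw0 : 0 ≤ w := le_trans hw₁0 hw.1
  have hw1 : w ≤ 1 := le_trans hw.2 hw₂1
  have hU := bandLevelU_mem_Icc_of_U hw0 hw1 hd hp hx
  constructor
  · exact (bandLevelU_ge_of_deriv_nonneg hκ₁ hderiv₁ hw.1).trans hU.1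
  · refine hU.2.trans ?_
    have hmax := bandLevelU_le_max_of_convex (Udd := d₂) (Upp := p₂) (Upd := x₂) hκ₂ hw
    have h12 : bandLevelU w₁ d₂ p₂ x₂ ≤ bandLevelU w₂ d₂ p₂ x₂ :=
      bandLevelU_ge_of_deriv_nonneg hκ₂ hderiv₂ (le_trans hw.1 hw.2)
    rw [max_eq_right h12] at hmax
    exact hmax

end Summit.Ventures.CertifiedManyBodySolver.Downfold.Emery
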